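import Summits.ResolutionOfSingularities.ResolutionOfSingularities.Theorems.MarkedTransferCampaignW23DirectionTransport
import Summits.ResolutionOfSingularities.ResolutionOfSingularities.Theorems.MarkedTransferCampaignW23CotangentFlagProof
import HarnessLib

/-!
# [OURS · L1 W2.3] `KnockoutTransportComp`, `ThetaLevelTransport`, `DirectionFlagTransport` HOLD — proofs for
# `Theorems/MarkedTransferCampaignW23DirectionTransport.lean`

HONEST FRAMING. Everything below is OURS (cell `res-hironaka`, run/shared/lean/pub/res-hironaka/, rung L of
LADDER-RESOLUTION, RESCUE-SEED slot W2.3 «TAILS WITHOUT H♭»; seat `res-L1-s23-pv-1`, gen 5) or elementary algebra;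
NOTHING here is a statement of H. Hironaka's manuscript *Resolution of singularities in positive characteristics*
(2017-03-23, [Hironaka2017], lit key `paper:url-3343fd9e678b`) and nothing asserts that any statement of that manuscript
holds. Inputs: p513000 `exists_partialDescent_of_mem_theta_ours` / `mem_theta_ours_of_partialDescent`; the push-forward
of partial descents is re-proved here from level `k` upward (p505613 `exists_pushDescent` starts at level `0`).
AI review is weaker than expert review.

CONTENTS (all OURS): `knockoutTransport_comp`, `exists_pushPartialDescent`, `theta_ours_level_transport`,
`cotFlag_level_transport` and the three `_holds` theorems.

## References
* Theorems/MarkedTransferCampaignW23DirectionTransport.lean (statements, this seat); …BlowupTransportProof.lean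
  (p505613); …CotangentFlagProof.lean (p513000) (cell, OURS).
-/

set_option linter.dupNamespace false -- mandated namespace of this single-conjunct summit

namespace Summit.ResolutionOfSingularities.ResolutionOfSingularities.Theorems

namespace CampaignW23

open Literature.AlgebraicGeometry.Hironaka2017.S16Proof

universe u

section General

variable {p : ℕ} [Fact p.Prime] {O : Type u} [CommRing O] [CharP O p] {O' : Type u} [CommRing O'] [CharP O' p]
  {O'' : Type u} [CommRing O''] [CharP O'' p] {ℓ ℓ' ℓ'' : ℕ}

/-- [OURS · L1 W2.3] THE WEIGHT LAW COMPOSES (universe-polymorphic form of `KnockoutTransportComp`). NOT a statement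
of the manuscript. [folklore] -/
theorem knockoutTransport_comp (I : InductionInput p O ℓ) (I' : InductionInput p O' ℓ') (I'' : InductionInput p O'' ℓ'')
    (φ : O →+* O') (z : O') (ψ : O' →+* O'') (w : O'') (hee : I.e ≤ I'.e)
    (h1 : KnockoutTransport I I' φ z) (h2 : KnockoutTransport I' I'' ψ w) :
    KnockoutTransport I I'' (ψ.comp φ) (ψ z * w) := by
  intro k hk1 hke h hh
  obtain ⟨h', hh', e1⟩ := h1 k hk1 hke h hh
  obtain ⟨h'', hh'', e2⟩ := h2 k hk1 (hke.trans hee) h' hh'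
  refine ⟨h'', hh'', ?_⟩
  rw [RingHom.comp_apply, e1, map_mul, map_pow, e2, mul_pow]
  ring

/-- [OURS · L1 W2.3] PARTIAL DESCENTS PUSH FORWARD under the law, from level `k` upward (the analogue of p505613
`exists_pushDescent`, which starts at level `0`): given `φ (c k) = z^{p^k}·t′`, the entries above `k` transport with
weights `p^j` and the transported knock-outs stay in the bracketed negative sums. NOT a statement of the manuscript.
[folklore] -/
theorem exists_pushPartialDescent (I : InductionInput p O ℓ) (I' : InductionInput p O' ℓ') (φ : O →+* O') (z : O')
    (hlaw : KnockoutTransport I I' φ z) {c : ℕ → O} {k : ℕ}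
    (hc : ∀ j : ℕ, k < j → j ≤ I.e → c j - c (j - 1) ^ p ∈ forgetDegrees p O ℓ (I.negaSum j))
    {t' : O'} (ht : φ (c k) = z ^ p ^ k * t') :
    ∀ n : ℕ, k + n ≤ I.e → ∃ d : ℕ → O', d k = t' ∧ (∀ j : ℕ, k ≤ j → j ≤ k + n → φ (c j) = z ^ p ^ j * d j) ∧
      (∀ j : ℕ, k < j → j ≤ k + n → d j - d (j - 1) ^ p ∈ forgetDegrees p O' ℓ' (I'.negaSum j)) := by
  intro n
  induction n with
  | zero =>
    intro _
    refine ⟨fun _ => t', rfl, ?_, ?_⟩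
    · intro j hj1 hj2
      obtain rfl : j = k := by omega
      exact ht
    · intro j hj1 hj2
      omega
  | succ n ih =>
    intro hkn
    obtain ⟨d, hdk, hdφ, hdd⟩ := ih (by omega)
    have hmem : c (k + n + 1) - c (k + n) ^ p ∈ forgetDegrees p O ℓ (I.negaSum (k + n + 1)) := by
      have h := hc (k + n + 1) (by omega) (by omega)
      rwa [Nat.add_sub_cancel] at h
    obtain ⟨h', hh', hφ⟩ := hlaw (k + n + 1) (by omega) (by omega) _ hmem
    refine ⟨Function.update d (k + n + 1) (d (k + n) ^ p + h'), ?_, ?_, ?_⟩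
    · rw [Function.update_of_ne (by omega), hdk]
    · intro j hj1 hj2
      rcases Nat.lt_or_eq_of_le hj2 with hj | hj
      · rw [Function.update_of_ne (by omega)]
        exact hdφ j hj1 (by omega)
      · rw [show k + (n + 1) = k + n + 1 by omega] at hj
        subst hj
        rw [Function.update_self]
        have e1 : c (k + n + 1) = (c (k + n + 1) - c (k + n) ^ p) + c (k + n) ^ p := by ring
        rw [e1, map_add, map_pow, hφ, hdφ (k + n) (by omega) (by omega)]
        ring
    · intro j hj1 hj2
      rcases Nat.lt_or_eq_of_le hj2 with hj | hj
      · rw [Function.update_of_ne (by omega), Function.update_of_ne (by omega)]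
        exact hdd j hj1 (by omega)
      · rw [show k + (n + 1) = k + n + 1 by omega] at hj
        subst hj
        rw [Function.update_self, Nat.add_sub_cancel, Function.update_of_ne (by omega), add_sub_cancel_left]
        exact hh'

/-- [OURS · L1 W2.3] THE WHOLE FLAG TRANSPORTS, LEVEL `k` WITH WEIGHT `p^k` (universe-polymorphic form of
`ThetaLevelTransport`). NOT a statement of the manuscript. [folklore] -/
theorem theta_ours_level_transport (I : InductionInput p O ℓ) (I' : InductionInput p O' ℓ') (φ : O →+* O') (z : O')
    (hz : z ∈ nonZeroDivisors O') (he : I'.e = I.e) (hlaw : KnockoutTransport I I' φ z)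
    (hL : ∀ g ∈ I.L I.e, ∃ g' ∈ I'.L I'.e, φ g = z ^ p ^ I.e * g')
    {k : ℕ} (hk : k ≤ I.e) {t : O} {t' : O'} (ht : φ t = z ^ p ^ k * t') (hmem : t ∈ I.theta_ours k) :
    t' ∈ I'.theta_ours k := by
  obtain ⟨c, hck, hce, hcd⟩ := exists_partialDescent_of_mem_theta_ours I hk hmem
  have ht' : φ (c k) = z ^ p ^ k * t' := by rw [hck, ht]
  obtain ⟨d, hdk, hdφ, hdd⟩ :=
    exists_pushPartialDescent I I' φ z hlaw hcd ht' (I.e - k) (by omega)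
  have hke : k + (I.e - k) = I.e := by omega
  -- the top entry is pinned: `z^{p^e} · d e = φ (c e) = z^{p^e} · g′`
  obtain ⟨g', hg', hφg⟩ := hL (c I.e) hce
  have htop : φ (c I.e) = z ^ p ^ I.e * d I.e := hdφ I.e hk (by omega)
  have hdg : d I.e = g' := by
    have h0 : z ^ p ^ I.e * d I.e = z ^ p ^ I.e * g' := by rw [← htop, ← hφg]
    exact (mul_cancel_left_mem_nonZeroDivisors (pow_mem hz _)).mp h0
  have hde : d I'.e ∈ I'.L I'.e := by
    have h := hg'
    rw [he] at h ⊢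
    rw [hdg]
    exact h
  have hk' : k ≤ I'.e := by rw [he]; exact hk
  have hdd' : ∀ j : ℕ, k < j → j ≤ I'.e → d j - d (j - 1) ^ p ∈ forgetDegrees p O' ℓ' (I'.negaSum j) :=
    fun j hj1 hj2 => hdd j hj1 (by rw [he] at hj2; omega)
  rw [← hdk]
  exact mem_theta_ours_of_partialDescent I' hde hk' hdd'

/-- [OURS · L1 W2.3] THE DIRECTION FLAG TRANSPORTS (universe-polymorphic form of `DirectionFlagTransport`).
NOT a statement of the manuscript. [folklore] -/
theorem cotFlag_level_transport (I : InductionInput p O ℓ) (I' : InductionInput p O' ℓ') (φ : O →+* O') (z : O')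
    (M : Ideal O) (M' : Ideal O') (hz : z ∈ nonZeroDivisors O') (he : I'.e = I.e)
    (hlaw : KnockoutTransport I I' φ z) (hL : ∀ g ∈ I.L I.e, ∃ g' ∈ I'.L I'.e, φ g = z ^ p ^ I.e * g')
    (hM : Ideal.map φ M ≤ Ideal.span {z} * M') {k : ℕ} (hk : k ≤ I.e)
    {y : O} {y' : O'} (hy : φ y = z * y') (hmem : y ∈ cotFlag I M k) : y' ∈ cotFlag I' M' k := by
  obtain ⟨θ, hθ, hθy⟩ := hmem
  -- `φ(θ − y^{p^k}) ∈ (z^{p^k+1})·M′^{p^k+1}`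
  have hle : Ideal.map φ M ^ (p ^ k + 1) ≤ Ideal.span {z ^ (p ^ k + 1)} * M' ^ (p ^ k + 1) :=
    calc Ideal.map φ M ^ (p ^ k + 1) ≤ (Ideal.span {z} * M') ^ (p ^ k + 1) := Ideal.pow_right_mono hM _
      _ = Ideal.span {z ^ (p ^ k + 1)} * M' ^ (p ^ k + 1) := by rw [mul_pow, Ideal.span_singleton_pow]
  have h1 : φ (θ - y ^ p ^ k) ∈ Ideal.span {z ^ (p ^ k + 1)} * M' ^ (p ^ k + 1) := by
    refine hle ?_
    rw [← Ideal.map_pow]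
    exact Ideal.mem_map_of_mem φ hθy
  obtain ⟨δ, hδ, hzδ⟩ := Ideal.mem_span_singleton_mul.mp h1
  have hθ' : φ θ = z ^ p ^ k * (y' ^ p ^ k + z * δ) := by
    rw [show θ = y ^ p ^ k + (θ - y ^ p ^ k) by ring, map_add, map_pow, hy, ← hzδ, mul_pow, pow_succ]
    ring
  refine ⟨y' ^ p ^ k + z * δ, theta_ours_level_transport I I' φ z hz he hlaw hL hk hθ' hθ, ?_⟩
  rw [add_sub_cancel_left]
  exact Ideal.mul_mem_left _ _ hδ

end General

/-! ## The closed statements HOLD -/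

/-- [OURS · L1 W2.3] `KnockoutTransportComp p` HOLDS for every prime `p`. NOT a statement of the manuscript.
[folklore] -/
theorem knockoutTransportComp_holds (p : ℕ) [Fact p.Prime] : KnockoutTransportComp p :=
  fun _ _ _ _ _ _ _ _ _ _ _ _ I I' I'' φ z ψ w hee h1 h2 => knockoutTransport_comp I I' I'' φ z ψ w hee h1 h2

/-- [OURS · L1 W2.3] `ThetaLevelTransport p` HOLDS for every prime `p`. NOT a statement of the manuscript.
[folklore] -/
theorem thetaLevelTransport_holds (p : ℕ) [Fact p.Prime] : ThetaLevelTransport p :=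
  fun _ _ _ _ _ _ _ _ I I' φ z hz he hlaw hL _ hk _ _ ht hmem =>
    theta_ours_level_transport I I' φ z hz he hlaw hL hk ht hmem

/-- [OURS · L1 W2.3] `DirectionFlagTransport p` HOLDS for every prime `p`. NOT a statement of the manuscript.
[folklore] -/
theorem directionFlagTransport_holds (p : ℕ) [Fact p.Prime] : DirectionFlagTransport p :=
  fun _ _ _ _ _ _ _ _ I I' φ z M M' hz he hlaw hL hM _ hk _ _ hy hmem =>
    cotFlag_level_transport I I' φ z M M' hz he hlaw hL hM hk hy hmem

end CampaignW23

end Summit.ResolutionOfSingularities.ResolutionOfSingularities.Theorems
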